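import Literature.AlgebraicGeometry.AbelianSchemes.WeilUnitOfTorsionPoint
import Literature.AlgebraicGeometry.AbelianSchemes.TorsionSectionPairingTensor
import Literature.AlgebraicGeometry.AbelianSchemes.PoincareSheafBiadditive
import HarnessLib

/-!
# The Weil unit is multiplicative in the dual variable: `e_n(x, ŷ₁ ŷ₂) = e_n(x, ŷ₁) · e_n(x, ŷ₂)` ([MumfordAV1970] §20 p. 184)

Layer `Literature/AlgebraicGeometry/AbelianSchemes`, namespace `Literature.AlgebraicGeometry.AbelianSchemes.AbelianSchemeOver.DualPair`.
THEOREMS ONLY (no definition, no named fact, no instance, no notation, no `sorry`).  Cell `hodgecm-mathlib` (D-0151), FLOOR 0, P6 «MOD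
programme» (crux hLiu418 = stmt-HodgeConjecture-24832), W-line `Cruxes/HLiu418/Lines/F0_P6b_WeilCartierDuality.lean`, letter `stub_W1`
«WeilPairingNatural», σ1 road (B-p08 (g32) `F0/P6/B-p08/g32/ROAD-sigma1-WeilPairingNatural.v1.B-p08g32.md`), organ **(σ1-c)** — the Poincaré
instance for ★ `DualPair.weilUnit` (B-p08 (g32), `WeilUnitOfTorsionPoint`) of ★ `TorsionPairing.exists_pairingUnit_of_iso_tensor`
(B-p18 (g37), `TorsionSectionPairingTensor`) along ★ (P-⊗) `DualPair.nonempty_pullbackP_mul_iso` (`L_{ŷ₁ŷ₂} ≅ L_{ŷ₁} ⊗ L_{ŷ₂}`,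
`PoincareSheafBiadditive`).  With ★ `weilUnit_mul` (multiplicativity in the torsion section) this makes `(x, ŷ) ↦ e_n(x, ŷ)` a
BI-MULTIPLICATIVE pairing `A_T[n](T) × Â[n](T) → μ_n(Γ(T, 𝒪_T))` — the input (a1) «`u` multiplicative in the `Ĝ`-variable» of the Cartier dock
(σ1-a) and of the assembly (σ1-f).  HC_CM is proved only modulo the printed citations until rung 0 closes; nothing here is about HC.

* **`weilUnit_mul_right`** — for `n`-torsion `T`-points `ŷ₁`, `ŷ₂` of `Â` (and `ŷ₁ŷ₂`, no commutativity of `Â(T)` assumed) and an `n`-torsion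
  section `x` of `A_T`: `weilUnit D hD n f (ŷ₁ * ŷ₂) _ x = weilUnit D hD n f ŷ₁ _ x * weilUnit D hD n f ŷ₂ _ x`.

## References
* [MumfordAV1970] D. Mumford, *Abelian Varieties* (1970), §20 (pp. 183–184: `e_n` is a pairing), §8 (pp. 74–75).
* [MilneAV2008] J. S. Milne, *Abelian Varieties* (2008), I §11 (bi-multiplicativity of `e_m`).
-/

set_option autoImplicit false

noncomputable section

-- `TopCat.Presheaf`/`Scheme.Modules` are not reducible (as in Mathlib's `AlgebraicGeometry/Modules` and ★ `TorsionSectionPairing*`).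
set_option backward.isDefEq.respectTransparency false

universe u

open CategoryTheory CategoryTheory.Limits AlgebraicGeometry MonoidalCategory CartesianMonoidalCategory TopologicalSpace
  Opposite
open scoped MonObj

namespace Literature.AlgebraicGeometry.AbelianSchemes.AbelianSchemeOver.DualPair

open TorsionPairing Literature.AlgebraicGeometry.Modules

variable {S : Scheme.{u}} {A : AbelianSchemeOver S} [IsReduced S] [IsLocallyNoetherian S] (D : A.DualPair)
  (hD : Nonempty ((Scheme.Modules.pullback (DualPair.unitHatSlice D)).obj D.P ≅ SheafOfModules.unit _)) (n : ℕ)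
  {T : Scheme.{u}} (f : T ⟶ S) [IsLocallyNoetherian T] [IsCommMonObj (A.baseChange f).X]
  (c₁ c₂ : Over.mk f ⟶ D.hat.X) (hc₁ : c₁ ^ n = 1) (hc₂ : c₂ ^ n = 1) (h₁₂ : (c₁ * c₂) ^ n = 1)

/-- **`e_n(x, ŷ₁ ŷ₂) = e_n(x, ŷ₁) · e_n(x, ŷ₂)` — THE WEIL UNIT IS MULTIPLICATIVE IN THE POINT OF THE DUAL** ([MumfordAV1970] §20 p. 184;
[MilneAV2008] I §11).  `L_{ŷ₁ŷ₂} ≅ L_{ŷ₁} ⊗ L_{ŷ₂}` (★ (P-⊗) `nonempty_pullbackP_mul_iso`, `S` reduced locally Noetherian, unit hypothesis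
`hD`), so the tensor product of trivialisations of `[n]^*L_{ŷ₁}`, `[n]^*L_{ŷ₂}` trivialises `[n]^*L_{ŷ₁ŷ₂}` with pairing units the product
(★ `exists_pairingUnit_of_iso_tensor`), and `weilUnit` is canonical (★ `eq_weilUnit`). [cite: MumfordAV1970, §20 (p. 184)] [cite: MilneAV2008, I §11] -/
theorem weilUnit_mul_right (g : (A.baseChange f).torsionSections n) :
    D.weilUnit hD n f (c₁ * c₂) h₁₂ g = D.weilUnit hD n f c₁ hc₁ g * D.weilUnit hD n f c₂ hc₂ g := by
  obtain ⟨e₁, he₁⟩ := D.weilUnit_spec hD n f c₁ hc₁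
  obtain ⟨e₂, he₂⟩ := D.weilUnit_spec hD n f c₂ hc₂
  obtain ⟨m⟩ := D.nonempty_pullbackP_mul_iso hD f c₁ c₂
  obtain ⟨E, hE⟩ := exists_pairingUnit_of_iso_tensor (A.baseChange f) ((A.baseChange f).translationActionMulN n)
    (hasRank_pullbackP D f c₁) (hasRank_pullbackP D f c₂) e₁ e₂ _ _ he₁ he₂ m
  exact (D.eq_weilUnit hD n f (c₁ * c₂) h₁₂ E g _ (hE g)).symm

end Literature.AlgebraicGeometry.AbelianSchemes.AbelianSchemeOver.DualPair

end
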